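import Literature.Probability.LatticeModels.WeakMixingBlockCoupling
import Literature.Probability.LatticeModels.WeakMixingBoundarySurgery
import Literature.Probability.LatticeModels.FRPotentialSpecTranslation
import HarnessLib

/-!
# [MOS94] Theorem 1.1 — weak mixing implies strong mixing on squares in two dimensions — PROVED
# (`MOS1994_weakMixing_imp_strongMixing_holds`)

Topic `Literature/Probability/LatticeModels`; cell `ym-ir`, seat lit-3 (census row B2).  THEOREMS ONLY (D-0026):
this file DISCHARGES the named fact `MOS1994_weakMixing_imp_strongMixing` of `StrongMixingFiniteSize.lean`
(F. Martinelli, E. Olivieri, R. H. Schonmann, *For 2-D lattice spin systems weak mixing implies strong mixing*,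
Commun. Math. Phys. 165 (1994) 33–47, Theorem 1.1 p0005 L52–56): for a finite-range, translation-invariant
interaction with finite single-spin space on `ℤ²`, `WM(Λ, C, γ)` for all finite `Λ` implies `SM(Λ_L, C′, γ′)`
for every square `Λ_L`.

## The printed proof and the tree's rendering

[MOS94] p0005 L65 – p0006 L44: Theorem 1.1 follows from Proposition 2.1 (the surgery estimate, PROVED in
`WeakMixingBoundarySurgery.lean`) and «the following result which was proved in Sect. 4 of [MO1]» (F. Martinelli,
E. Olivieri, CMP 161 (1994) 447–486, Thm 4.1 / Prop 4.1; Theorem 2.1 of [MOS94]): a finite-size condition on ONE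
square `Λ_{L₀}` implies strong mixing on all squares, via block Glauber dynamics (uniform spectral gap) and
«gap ⇒ strong mixing».  [MO1] is not held (acq-03742).  The tree replaces [MO1]'s spectral route by the
coupling analysis of the same block heat-bath dynamics of `WeakMixingBlockCoupling.lean`
(`BlockCoupling.abs_sub_le_of_blockFamily`); this file supplies the two model-specific ingredients:

* the ONE-BLOCK INPUT for translates of `Λ_{L₀}` (`input_blk`): [MOS94] (2.1) at free scales
  (`WeakMixingSurgery.MOS1994_eq2_1_scales`: events at distance `≥ q²` from the disagreement sites of the two
  boundary conditions, `q⁴ ≤ L₀`, error `(1 − δ₀)^{q−3}` per disagreement site), transported to the translates by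
  the translation covariance of the Gibbs kernels (`FRPotential.integral_spec_image_add`);
* the COVERING CONDITION for the square (`covering_condition`): blocks are ALL translates `Λ_{L₀} + u ⊆ Λ_L`,
  drawn with product weights `ω(u) = ω₁(u₀) ω₁(u₁)`, `ω₁ = W` at the two extreme positions (blocks touching a
  face) and `1` otherwise; per coordinate the boundary-hit weight is at most `η` times the coverage weight
  (`near1_sub_cov1_le`, zones: near a face the face blocks of weight `W ≥ 6A r` dominate the `r` hovering
  block boundaries; in the bulk the `2L₀ + 1` covering positions dominate `W + 2r`), whence
  `A · π{u : z ∈ ∂_r^+B_u} + 1/(2Z) ≤ π{u : z ∈ B_u}` on `Λ_L`;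
and the choice of constants: reach `g = q²`, `A₀ = 28q⁴ ≥ A`, face weight `W = 168q⁴r + 1` (`Wc`),
`L₀ ≥ L0c = 84q⁴(168q⁴r + 2r + 1)`, `m = 1/(q² + 2L₀ + r + 1)`, and (`exists_scale`) `q` beyond the threshold
of (2.1) with `3(2L₀+1)²(1 − δ₀)^{q−3} ≤ 1` (from `x^k e^{−x} → 0`); squares with `L ≤ 2L₀ + r` are covered by
the trivial bound.  The bootstrap itself is stated as a FINITE-SIZE CRITERION (`strongMixing_of_finiteSize`,
the tree's form of [MOS94] Theorem 2.1 = [MO1] Thm 4.1 + Prop 4.1, with the (2.1)-type input on ONE square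
`Λ_{L₀}` and output `SM` on all squares).
Net: `theorem MOS1994_weakMixing_imp_strongMixing_holds : MOS1994_weakMixing_imp_strongMixing U`.

References: [MOS94] Thm 1.1, §2 (2.1)–(2.2) [cite: MartinelliOlivieriSchonmann1994, Theorem 1.1]; [MO1] Thm 4.1
/ Prop 4.1 as quoted in [MOS94] p0006 L25–34 (block dynamics; replaced here by the coupling contraction);
[Mar99] F. Martinelli, LNM 1717, Thm 2.5 (= [MOS94] Thm 1.1 for `S = {−1,+1}`).  SIBLING-SETTING result
(classical finite-range lattice spin systems with finite spin space); nothing here concerns gauge theories;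
the Yang–Mills mass gap (Clay) is NOT touched (R4 closes only the conditional finite-𝕋⁴ rung
`BalabanLadder.UV`).
-/

open MeasureTheory Finset Filter

noncomputable section

namespace Literature.Probability.LatticeModels

namespace WeakMixingSquares

open BlockCoupling BoundarySurgery WeakMixingSurgery DisagreementCoupling

universe v

variable {S : Type v} [MeasurableSpace S] [MeasurableSingletonClass S] [Fintype S] [Nonempty S]
  [DecidableEq S] {r : ℕ}

open scoped Classical

/-! ### The blocks: translates of the square `Λ_{L₀}` -/

/-- The block `B_u = Λ_{L₀} + u`. [cite: MartinelliOlivieriSchonmann1994, Theorem 2.1 (the square `Λ_{L₀}`)] -/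
def blk (L₀ : ℕ) (u : Site 2) : Finset (Site 2) := (centeredCube 2 L₀).image (· + u)

omit [MeasurableSpace S] [MeasurableSingletonClass S] [Fintype S] [Nonempty S] [DecidableEq S] in
/-- Membership in a block: `x ∈ Λ_{L₀} + u ↔ |x_i − u_i| ≤ L₀` for both coordinates. [folklore] -/
private theorem mem_blk {L₀ : ℕ} {u x : Site 2} : x ∈ blk L₀ u ↔ ∀ i, |x i - u i| ≤ L₀ := by
  unfold blk
  rw [Finset.mem_image]
  constructor
  · rintro ⟨w, hw, rfl⟩ i
    have := (mem_centeredCube.1 hw) i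
    simp only [Pi.add_apply, add_sub_cancel_right]
    exact abs_le.2 ⟨this.1, this.2⟩
  · intro h
    refine ⟨x - u, mem_centeredCube.2 fun i => ?_, sub_add_cancel x u⟩
    have := abs_le.1 (h i)
    simpa only [Pi.sub_apply] using this

omit [MeasurableSpace S] [MeasurableSingletonClass S] [Fintype S] [Nonempty S] [DecidableEq S] in
/-- `|x_i − z_i| ≤ d(x,z)` in `ℤ`-absolute-value form. [folklore] -/
private theorem abs_sub_le_supDist (x z : Site 2) (i : Fin 2) : |x i - z i| ≤ (supDist x z : ℤ) := by
  have h := natAbs_sub_le_supDist x z i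
  have : |x i - z i| = ((x i - z i).natAbs : ℤ) := (Int.natCast_natAbs _).symm
  rw [this]
  exact_mod_cast h

omit [MeasurableSpace S] [MeasurableSingletonClass S] [Fintype S] [Nonempty S] [DecidableEq S] in
/-- `d(x,z) ≤ n` from coordinatewise bounds. [folklore] -/
private theorem supDist_le_of_abs_le {x z : Site 2} {n : ℕ} (h : ∀ i, |x i - z i| ≤ n) : supDist x z ≤ n := by
  rw [supDist_le_iff]
  intro i
  have := h i
  rw [Int.abs_eq_natAbs] at this
  exact_mod_cast this

omit [MeasurableSpace S] [MeasurableSingletonClass S] [Fintype S] [Nonempty S] [DecidableEq S] in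
/-- A site of `∂_r^+B_u` is within `L₀ + r` of `u` in every coordinate (and outside `B_u`). [folklore] -/
private theorem abs_le_of_mem_rOuterBoundary_blk {L₀ : ℕ} {u z : Site 2} (hz : z ∈ rOuterBoundary r (blk L₀ u)) :
    z ∉ blk L₀ u ∧ ∀ i, |z i - u i| ≤ (L₀ : ℤ) + r := by
  obtain ⟨hzB, w, hw, hzw⟩ := mem_rOuterBoundary.1 hz
  refine ⟨hzB, fun i => ?_⟩
  have h1 := abs_sub_le_supDist z w i
  have h2 := (mem_blk.1 hw) i
  have h3 : (supDist z w : ℤ) ≤ r := by exact_mod_cast hzw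
  calc |z i - u i| = |(z i - w i) + (w i - u i)| := by ring_nf
    _ ≤ |z i - w i| + |w i - u i| := abs_add_le _ _
    _ ≤ (L₀ : ℤ) + r := by linarith

omit [MeasurableSpace S] [MeasurableSingletonClass S] [Fintype S] [Nonempty S] [DecidableEq S] in
/-- Sites of `B_u` and of `∂_r^+B_u` are within `2L₀ + r` of each other. [folklore] -/
private theorem supDist_le_of_blk {L₀ : ℕ} {u x z : Site 2} (hx : x ∈ blk L₀ u) (hz : z ∈ rOuterBoundary r (blk L₀ u)) :
    supDist x z ≤ 2 * L₀ + r := by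
  refine supDist_le_of_abs_le fun i => ?_
  have h1 := (mem_blk.1 hx) i
  have h2 := (abs_le_of_mem_rOuterBoundary_blk hz).2 i
  rw [abs_sub_comm] at h2
  calc |x i - z i| = |(x i - u i) + (u i - z i)| := by ring_nf
    _ ≤ |x i - u i| + |u i - z i| := abs_add_le _ _
    _ ≤ ((2 * L₀ + r : ℕ) : ℤ) := by push_cast; linarith

omit [MeasurableSpace S] [MeasurableSingletonClass S] [Fintype S] [Nonempty S] [DecidableEq S] in
/-- `|B_u| = (2L₀+1)²`. [folklore] -/
private theorem card_blk (L₀ : ℕ) (u : Site 2) : (blk L₀ u).card = (2 * L₀ + 1) ^ 2 := by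
  unfold blk
  rw [Finset.card_image_of_injective _ (add_left_injective u), card_centeredCube]

omit [MeasurableSpace S] [MeasurableSingletonClass S] [Fintype S] [Nonempty S] [DecidableEq S] in
/-- Blocks at positions `|u_i| ≤ L − L₀` lie in the square `Λ_L`. [folklore] -/
private theorem blk_subset {L₀ L : ℕ} {u : Site 2} (hu : ∀ i, |u i| ≤ (L : ℤ) - L₀) : blk L₀ u ⊆ centeredCube 2 L := by
  intro x hx
  refine mem_centeredCube.2 fun i => ?_
  have h1 := abs_le.1 ((mem_blk.1 hx) i)
  have h2 := abs_le.1 (hu i)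
  constructor <;> linarith [h1.1, h1.2, h2.1, h2.2]

/-! ### The one-block input: [MOS94] (2.1) transported to the translates -/

omit [MeasurableSpace S] [MeasurableSingletonClass S] [Fintype S] [Nonempty S] [DecidableEq S] in
/-- The sup-distance is translation invariant. [folklore] -/
private theorem supDist_sub_right (x y k : Site 2) : supDist (x - k) (y - k) = supDist x y := by
  unfold supDist
  congr 1
  funext i
  congr 1
  simp only [Pi.sub_apply]
  ring

omit [MeasurableSpace S] [MeasurableSingletonClass S] [Fintype S] [Nonempty S] [DecidableEq S] in
/-- Translating the outer boundary: `z ∈ ∂_r^+Λ_{L₀} ⇒ z + u ∈ ∂_r^+(Λ_{L₀} + u)`. [folklore] -/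
private theorem add_mem_rOuterBoundary_blk {L₀ : ℕ} {u z : Site 2} (hz : z ∈ rOuterBoundary r (centeredCube 2 L₀)) :
    z + u ∈ rOuterBoundary r (blk L₀ u) := by
  obtain ⟨hzΛ, w, hw, hzw⟩ := mem_rOuterBoundary.1 hz
  refine mem_rOuterBoundary.2 ⟨fun h => hzΛ ?_, w + u, Finset.mem_image.2 ⟨w, hw, rfl⟩, ?_⟩
  · obtain ⟨w', hw', he⟩ := Finset.mem_image.1 h
    have : w' = z := add_right_cancel he
    rwa [this] at hw'
  · have := supDist_sub_right (z + u) (w + u) u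
    simp only [add_sub_cancel_right] at this
    rw [← this]
    exact hzw

omit [Nonempty S] [DecidableEq S] in
/-- Translation covariance of the Gibbs kernels on events:
`μ_{Λ+k}^τ(E) = μ_Λ^{τ(·+k)}(θ_k⁻¹ E)`. [cite: MartinelliOlivieriSchonmann1994, §1 H2] -/
private theorem spec_real_image_add (U : FRPotential 2 S r) (β : ℝ) (k : Site 2) (Λ : Finset (Site 2))
    (τ : Site 2 → S) {E : Set (Site 2 → S)} (hE : MeasurableSet E) :
    (U.spec β (Λ.image (· + k)) τ).real E = (U.spec β Λ (configShift (-k) τ)).real ((configShift k) ⁻¹' E) := by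
  have hE' : MeasurableSet ((configShift (S := S) k) ⁻¹' E) := (configShift k).measurable hE
  rw [← integral_indicator_one hE, ← integral_indicator_one hE']
  rw [U.integral_spec_image_add β k Λ τ ((measurable_one.indicator hE))]
  refine integral_congr_ae (Filter.Eventually.of_forall fun ω => ?_)
  simp only [Set.indicator, Set.mem_preimage, Pi.one_apply]

omit [Nonempty S] in
/-- **The one-block input transported to the translates**: if the square `Λ_{L₀}` satisfies the (2.1)-type
bound `|μ_{Λ_{L₀}}^τ(E) − μ_{Λ_{L₀}}^{τ′}(E)| ≤ ε · #{z ∈ ∂_r^+Λ_{L₀} : τ z ≠ τ′ z}` for all `τ, τ′` and all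
events `E` of the spins at distance `≥ q²` from those disagreement sites, then so does every block
`B_u = Λ_{L₀} + u` (events at distance `> q²`; translation covariance of the Gibbs kernels).
[cite: MartinelliOlivieriSchonmann1994, §2 (2.1)] -/
theorem input_blk (U : FRPotential 2 S r) (β : ℝ) {ε : ℝ} (hε : 0 ≤ ε) {q L₀ : ℕ}
    (h : ∀ (τ τ' : Site 2 → S) (E : Set (Site 2 → S)), MeasurableSet E →
      DependsOn (· ∈ E) {x | x ∈ centeredCube 2 L₀ ∧
        ∀ z ∈ rOuterBoundary r (centeredCube 2 L₀), τ z ≠ τ' z → q ^ 2 ≤ supDist x z} →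
      |(U.spec β (centeredCube 2 L₀) τ).real E - (U.spec β (centeredCube 2 L₀) τ').real E| ≤
        ((rOuterBoundary r (centeredCube 2 L₀)).filter (fun z => τ z ≠ τ' z)).card * ε)
    (u : Site 2) (η₁ η₂ : Site 2 → S) {E : Set (Site 2 → S)} (hE : MeasurableSet E)
    (hdep : DependsOn (· ∈ E) {x | x ∈ blk L₀ u ∧
      ∀ z ∈ rOuterBoundary r (blk L₀ u), η₁ z ≠ η₂ z → q ^ 2 < supDist x z}) :
    |(U.spec β (blk L₀ u) η₁).real E - (U.spec β (blk L₀ u) η₂).real E| ≤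
      ε * ((rOuterBoundary r (blk L₀ u)).filter (fun z => η₁ z ≠ η₂ z)).card := by
  set τ₁ : Site 2 → S := configShift (-u) η₁ with hτ₁
  set τ₂ : Site 2 → S := configShift (-u) η₂ with hτ₂
  set E' : Set (Site 2 → S) := (configShift u) ⁻¹' E with hE'
  have hE'm : MeasurableSet E' := (configShift u).measurable hE
  have hτ : ∀ z, τ₁ z = η₁ (z + u) ∧ τ₂ z = η₂ (z + u) := fun z => by
    simp [hτ₁, hτ₂, configShift_apply, sub_neg_eq_add]
  -- the event `E'` is far from the disagreement sites of `τ₁, τ₂`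
  have hdep' : DependsOn (· ∈ E') {x | x ∈ centeredCube 2 L₀ ∧
      ∀ z ∈ rOuterBoundary r (centeredCube 2 L₀), τ₁ z ≠ τ₂ z → q ^ 2 ≤ supDist x z} := by
    intro σ σ' hσ
    simp only [hE', Set.mem_preimage]
    refine hdep fun x hx => ?_
    simp only [configShift_apply]
    refine hσ (x - u) ⟨?_, fun z hz hne => ?_⟩
    · obtain ⟨w, hw, he⟩ := Finset.mem_image.1 hx.1
      rw [← he, add_sub_cancel_right]; exact hw
    · have hz' : z + u ∈ rOuterBoundary r (blk L₀ u) := add_mem_rOuterBoundary_blk hz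
      have hne' : η₁ (z + u) ≠ η₂ (z + u) := by rwa [(hτ z).1, (hτ z).2] at hne
      have h1 := hx.2 (z + u) hz' hne'
      have h2 : supDist (x - u) z = supDist x (z + u) := by
        have := supDist_sub_right x (z + u) u
        rwa [add_sub_cancel_right] at this
      rw [h2]
      exact h1.le
  have key := h τ₁ τ₂ E' hE'm hdep'
  -- translate back
  have e1 : (U.spec β (blk L₀ u) η₁).real E = (U.spec β (centeredCube 2 L₀) τ₁).real E' :=
    spec_real_image_add U β u _ η₁ hE
  have e2 : (U.spec β (blk L₀ u) η₂).real E = (U.spec β (centeredCube 2 L₀) τ₂).real E' :=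
    spec_real_image_add U β u _ η₂ hE
  rw [e1, e2]
  refine key.trans ?_
  rw [mul_comm]
  refine mul_le_mul_of_nonneg_left ?_ hε
  -- the disagreement sites of `τ₁, τ₂` translate into those of `η₁, η₂`
  have hinj : Set.InjOn (fun z : Site 2 => z + u)
      ↑((rOuterBoundary r (centeredCube 2 L₀)).filter (fun z => τ₁ z ≠ τ₂ z)) :=
    fun a _ b _ hab => add_right_cancel hab
  have hmaps : ∀ z ∈ (rOuterBoundary r (centeredCube 2 L₀)).filter (fun z => τ₁ z ≠ τ₂ z),
      z + u ∈ (rOuterBoundary r (blk L₀ u)).filter (fun z => η₁ z ≠ η₂ z) := by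
    intro z hz
    obtain ⟨hzB, hne⟩ := Finset.mem_filter.1 hz
    refine Finset.mem_filter.2 ⟨add_mem_rOuterBoundary_blk hzB, ?_⟩
    rwa [(hτ z).1, (hτ z).2] at hne
  exact_mod_cast Finset.card_le_card_of_injOn (fun z => z + u) hmaps hinj

/-! ### The weights: one coordinate -/

/-- The one-dimensional position weight: `W` at the two extreme positions `±P` (blocks touching a face),
`1` elsewhere. [cite: MartinelliOlivieriSchonmann1994, Theorem 2.1 (block dynamics of [MO1])] -/
def ω1 (P : ℤ) (W : ℝ) (u : ℤ) : ℝ := if |u| = P then W else 1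

/-- The coverage weight of the coordinate `t`: `Σ_{|u| ≤ P, |t − u| ≤ L₀} ω₁(u)`. [folklore] -/
def cov1 (P : ℤ) (L₀ : ℕ) (W : ℝ) (t : ℤ) : ℝ :=
  ∑ u ∈ Finset.Icc (-P) P, ω1 P W u * (if |t - u| ≤ (L₀ : ℤ) then 1 else 0)

/-- The near weight of the coordinate `t`: `Σ_{|u| ≤ P, |t − u| ≤ L₀ + r} ω₁(u)`. [folklore] -/
def near1 (P : ℤ) (L₀ r : ℕ) (W : ℝ) (t : ℤ) : ℝ :=
  ∑ u ∈ Finset.Icc (-P) P, ω1 P W u * (if |t - u| ≤ (L₀ : ℤ) + r then 1 else 0)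

omit [MeasurableSpace S] [MeasurableSingletonClass S] [Fintype S] [Nonempty S] [DecidableEq S] in
/-- `ω₁ ≥ 0` for `W ≥ 0`. [folklore] -/
private theorem ω1_nonneg {P : ℤ} {W : ℝ} (hW : 0 ≤ W) (u : ℤ) : 0 ≤ ω1 P W u := by
  unfold ω1; split_ifs <;> linarith

omit [MeasurableSpace S] [MeasurableSingletonClass S] [Fintype S] [Nonempty S] [DecidableEq S] in
/-- `ω₁ ≥ 1` for `W ≥ 1`. [folklore] -/
private theorem one_le_ω1 {P : ℤ} {W : ℝ} (hW : 1 ≤ W) (u : ℤ) : 1 ≤ ω1 P W u := by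
  unfold ω1; split_ifs <;> linarith

omit [MeasurableSpace S] [MeasurableSingletonClass S] [Fintype S] [Nonempty S] [DecidableEq S] in
/-- `ω₁ ≤ W` for `W ≥ 1`. [folklore] -/
private theorem ω1_le {P : ℤ} {W : ℝ} (hW : 1 ≤ W) (u : ℤ) : ω1 P W u ≤ W := by
  unfold ω1; split_ifs <;> linarith

omit [MeasurableSpace S] [MeasurableSingletonClass S] [Fintype S] [Nonempty S] [DecidableEq S] in
/-- `cov1 ≤ near1`. [folklore] -/
private theorem cov1_le_near1 (P : ℤ) (L₀ r : ℕ) {W : ℝ} (hW : 0 ≤ W) (t : ℤ) : cov1 P L₀ W t ≤ near1 P L₀ r W t := by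
  unfold cov1 near1
  refine Finset.sum_le_sum fun u _ => mul_le_mul_of_nonneg_left ?_ (ω1_nonneg hW u)
  split_ifs with h1 h2
  · exact le_rfl
  · exact absurd (h1.trans (by linarith)) h2
  · norm_num
  · exact le_rfl

omit [MeasurableSpace S] [MeasurableSingletonClass S] [Fintype S] [Nonempty S] [DecidableEq S] in
/-- **Coverage near a face**: if `|t| ≥ P − L₀` (the site is within `2L₀` of a face) the face block
contributes `W`. [folklore] -/
private theorem cov1_ge_W {P : ℤ} {L₀ : ℕ} {W : ℝ} (hW : 0 ≤ W) (hP : 0 ≤ P) {t : ℤ} (ht : |t| ≤ P + L₀)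
    (hface : P - L₀ ≤ |t|) : W ≤ cov1 P L₀ W t := by
  unfold cov1
  set uf : ℤ := if 0 ≤ t then P else -P with huf
  have hufmem : uf ∈ Finset.Icc (-P) P := by
    rw [Finset.mem_Icc, huf]; split_ifs <;> constructor <;> linarith
  have hufω : ω1 P W uf = W := by
    unfold ω1; rw [if_pos]; rw [huf]; split_ifs <;> simp [abs_of_nonneg hP]
  have hufd : |t - uf| ≤ (L₀ : ℤ) := by
    rw [huf]
    split_ifs with h
    · rw [abs_of_nonneg h] at ht hface
      rw [abs_le]; constructor <;> linarith
    · push Not at h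
      rw [abs_of_neg h] at ht hface
      rw [abs_le]; constructor <;> linarith
  have := Finset.single_le_sum (f := fun u => ω1 P W u * (if |t - u| ≤ (L₀ : ℤ) then 1 else 0))
    (fun u _ => mul_nonneg (ω1_nonneg hW u) (by split_ifs <;> norm_num)) hufmem
  simp only [hufω, if_pos hufd, mul_one] at this
  exact this

omit [MeasurableSpace S] [MeasurableSingletonClass S] [Fintype S] [Nonempty S] [DecidableEq S] in
/-- **Coverage in the bulk**: if `|t| < P − L₀` all `2L₀ + 1` positions `u ∈ [t − L₀, t + L₀]` cover `t`.
[folklore] -/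
private theorem cov1_ge_bulk {P : ℤ} {L₀ : ℕ} {W : ℝ} (hW : 1 ≤ W) {t : ℤ} (hbulk : |t| < P - L₀) :
    (2 * L₀ + 1 : ℝ) ≤ cov1 P L₀ W t := by
  unfold cov1
  have hsub : Finset.Icc (t - L₀) (t + L₀) ⊆ Finset.Icc (-P) P := by
    intro u hu
    rw [Finset.mem_Icc] at hu ⊢
    have := abs_lt.1 hbulk
    constructor <;> linarith [hu.1, hu.2, this.1, this.2]
  calc (2 * L₀ + 1 : ℝ) = ∑ u ∈ Finset.Icc (t - L₀) (t + L₀), (1 : ℝ) := by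
        rw [Finset.sum_const, nsmul_eq_mul, mul_one, Int.card_Icc]
        have : t + ↑L₀ + 1 - (t - ↑L₀) = ((2 * L₀ + 1 : ℕ) : ℤ) := by push_cast; ring
        rw [this, Int.toNat_natCast]; push_cast; ring
    _ ≤ ∑ u ∈ Finset.Icc (t - L₀) (t + L₀), ω1 P W u * (if |t - u| ≤ (L₀ : ℤ) then 1 else 0) := by
        refine Finset.sum_le_sum fun u hu => ?_
        rw [Finset.mem_Icc] at hu
        have hd : |t - u| ≤ (L₀ : ℤ) := abs_le.2 ⟨by linarith, by linarith⟩
        rw [if_pos hd, mul_one]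
        exact one_le_ω1 hW u
    _ ≤ _ := Finset.sum_le_sum_of_subset_of_nonneg hsub fun u _ _ =>
        mul_nonneg (ω1_nonneg (by linarith) u) (by split_ifs <;> norm_num)

omit [MeasurableSpace S] [MeasurableSingletonClass S] [Fintype S] [Nonempty S] [DecidableEq S] in
/-- **The boundary-hit weight**: `near1 − cov1 = Σ_u ω₁(u) 1{L₀ < |t−u| ≤ L₀+r}` is at most `r` within
`2L₀` of a face and at most `W + 2r` in the bulk (`P ≥ L₀ + r + 1`, `|t| ≤ P + L₀`). [folklore] -/
private theorem near1_sub_cov1_le {P : ℤ} {L₀ r : ℕ} {W : ℝ} (hW : 1 ≤ W) (hP : (L₀ : ℤ) + r + 1 ≤ P) {t : ℤ}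
    (ht : |t| ≤ P + L₀) :
    near1 P L₀ r W t - cov1 P L₀ W t ≤ if P - L₀ ≤ |t| then (r : ℝ) else W + 2 * r := by
  have hW0 : 0 ≤ W := by linarith
  -- the difference as one sum of `ω₁ · 1{L₀ < |t-u| ≤ L₀+r}`
  have hdiff : near1 P L₀ r W t - cov1 P L₀ W t =
      ∑ u ∈ Finset.Icc (-P) P, ω1 P W u * (if (L₀ : ℤ) < |t - u| ∧ |t - u| ≤ (L₀ : ℤ) + r then 1 else 0) := by
    unfold near1 cov1
    rw [← Finset.sum_sub_distrib]
    refine Finset.sum_congr rfl fun u _ => ?_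
    rw [← mul_sub]
    congr 1
    by_cases h1 : |t - u| ≤ (L₀ : ℤ)
    · rw [if_pos (h1.trans (by linarith)), if_pos h1, if_neg (fun h => absurd h1 (not_le.2 h.1))]; ring
    · push Not at h1
      rw [if_neg (not_le.2 h1)]
      by_cases h2 : |t - u| ≤ (L₀ : ℤ) + r
      · rw [if_pos h2, if_pos ⟨h1, h2⟩]; ring
      · rw [if_neg h2, if_neg (fun h => h2 h.2)]; ring
  rw [hdiff]
  -- split the positions into the two faces and the interior
  have hsplit : ∀ f : ℤ → ℝ, ∑ u ∈ Finset.Icc (-P) P, f u =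
      ∑ u ∈ (Finset.Icc (-P) P).filter (fun u => |u| = P), f u +
        ∑ u ∈ (Finset.Icc (-P) P).filter (fun u => ¬ |u| = P), f u :=
    fun f => (Finset.sum_filter_add_sum_filter_not _ _ f).symm
  rw [hsplit]
  -- face part: only the near face can be hit, and only from the bulk side
  have hface : ∑ u ∈ (Finset.Icc (-P) P).filter (fun u => |u| = P),
      ω1 P W u * (if (L₀ : ℤ) < |t - u| ∧ |t - u| ≤ (L₀ : ℤ) + r then 1 else 0) ≤
      if P - L₀ ≤ |t| then 0 else W := by
    have hset : (Finset.Icc (-P) P).filter (fun u => |u| = P) = {P, -P} := by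
      ext u
      simp only [Finset.mem_filter, Finset.mem_Icc, Finset.mem_insert, Finset.mem_singleton]
      constructor
      · rintro ⟨-, hu⟩
        rcases abs_eq (by linarith : (0 : ℤ) ≤ P) |>.1 hu with h | h
        · exact Or.inl h
        · exact Or.inr h
      · rintro (rfl | rfl)
        · exact ⟨⟨by linarith, le_rfl⟩, abs_of_nonneg (by linarith)⟩
        · exact ⟨⟨le_rfl, by linarith⟩, by rw [abs_neg, abs_of_nonneg (by linarith)]⟩
    rw [hset]
    have hPne : (P : ℤ) ≠ -P := by linarith
    rw [Finset.sum_pair hPne]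
    have hωP : ω1 P W P = W := by unfold ω1; rw [if_pos (abs_of_nonneg (by linarith))]
    have hωnP : ω1 P W (-P) = W := by unfold ω1; rw [if_pos (by rw [abs_neg, abs_of_nonneg (by linarith)])]
    rw [hωP, hωnP]
    by_cases ht0 : 0 ≤ t
    · -- the far face `-P` is never hit
      have h1 : ¬ ((L₀ : ℤ) < |t - -P| ∧ |t - -P| ≤ (L₀ : ℤ) + r) := by
        intro h
        have : |t - -P| = t + P := by rw [sub_neg_eq_add, abs_of_nonneg (by linarith)]
        rw [this] at h
        linarith [h.2]
      rw [if_neg h1, mul_zero, add_zero]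
      by_cases hface : P - L₀ ≤ |t|
      · rw [if_pos hface]
        have hind : ¬ ((L₀ : ℤ) < |t - P| ∧ |t - P| ≤ (L₀ : ℤ) + r) := by
          intro hn
          rw [abs_of_nonneg ht0] at hface ht
          have : |t - P| ≤ L₀ := abs_le.2 ⟨by linarith, by linarith⟩
          linarith [hn.1]
        rw [if_neg hind, mul_zero]
      · rw [if_neg hface]
        split_ifs
        · rw [mul_one]
        · rw [mul_zero]; exact hW0
    · push Not at ht0
      have h1 : ¬ ((L₀ : ℤ) < |t - P| ∧ |t - P| ≤ (L₀ : ℤ) + r) := by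
        intro h
        have : |t - P| = P - t := by rw [abs_sub_comm, abs_of_nonneg (by linarith)]
        rw [this] at h
        linarith [h.2]
      rw [if_neg h1, mul_zero, zero_add]
      by_cases hface : P - L₀ ≤ |t|
      · rw [if_pos hface]
        have hind : ¬ ((L₀ : ℤ) < |t - -P| ∧ |t - -P| ≤ (L₀ : ℤ) + r) := by
          intro hn
          rw [abs_of_neg ht0] at hface ht
          have : |t - -P| ≤ L₀ := by rw [sub_neg_eq_add]; exact abs_le.2 ⟨by linarith, by linarith⟩
          linarith [hn.1]
        rw [if_neg hind, mul_zero]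
      · rw [if_neg hface]
        split_ifs
        · rw [mul_one]
        · rw [mul_zero]; exact hW0
  -- interior part: at most `2r` positions, and at most `r` within `2L₀` of a face
  have hint : ∑ u ∈ (Finset.Icc (-P) P).filter (fun u => ¬ |u| = P),
      ω1 P W u * (if (L₀ : ℤ) < |t - u| ∧ |t - u| ≤ (L₀ : ℤ) + r then 1 else 0) ≤
      if P - L₀ ≤ |t| then (r : ℝ) else 2 * r := by
    -- rewrite the weights (`ω₁ = 1` off the faces) and bound by a count
    have h1 : ∑ u ∈ (Finset.Icc (-P) P).filter (fun u => ¬ |u| = P),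
        ω1 P W u * (if (L₀ : ℤ) < |t - u| ∧ |t - u| ≤ (L₀ : ℤ) + r then 1 else 0) =
        (((Finset.Icc (-P) P).filter (fun u => ¬ |u| = P)).filter
          (fun u => (L₀ : ℤ) < |t - u| ∧ |t - u| ≤ (L₀ : ℤ) + r)).card := by
      rw [← Finset.sum_boole]
      refine Finset.sum_congr rfl fun u hu => ?_
      have hω : ω1 P W u = 1 := by unfold ω1; rw [if_neg (Finset.mem_filter.1 hu).2]
      rw [hω, one_mul]
    rw [h1]
    set T := ((Finset.Icc (-P) P).filter (fun u => ¬ |u| = P)).filter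
      (fun u => (L₀ : ℤ) < |t - u| ∧ |t - u| ≤ (L₀ : ℤ) + r) with hT
    -- the two candidate intervals
    have hTsub : T ⊆ Finset.Icc (t - L₀ - r) (t - L₀ - 1) ∪ Finset.Icc (t + L₀ + 1) (t + L₀ + r) := by
      intro u hu
      obtain ⟨-, h1, h2⟩ := Finset.mem_filter.1 hu
      rw [Finset.mem_union, Finset.mem_Icc, Finset.mem_Icc]
      rcases le_or_gt 0 (t - u) with h | h
      · rw [abs_of_nonneg h] at h1 h2; left; constructor <;> linarith
      · rw [abs_of_neg h] at h1 h2; right; constructor <;> linarith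
    have hc1 : (Finset.Icc (t - L₀ - r) (t - L₀ - 1)).card = r := by
      rw [Int.card_Icc]; have : t - ↑L₀ - 1 + 1 - (t - ↑L₀ - ↑r) = (r : ℤ) := by ring
      rw [this, Int.toNat_natCast]
    have hc2 : (Finset.Icc (t + L₀ + 1) (t + L₀ + r)).card = r := by
      rw [Int.card_Icc]; have : t + ↑L₀ + ↑r + 1 - (t + ↑L₀ + 1) = (r : ℤ) := by ring
      rw [this, Int.toNat_natCast]
    split_ifs with hf
    · -- near a face: the interval on the far side of `t` leaves the admissible positions
      by_cases ht0 : 0 ≤ t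
      · rw [abs_of_nonneg ht0] at hf
        have hT' : T ⊆ Finset.Icc (t - L₀ - r) (t - L₀ - 1) := by
          intro u hu
          have hu' := hTsub hu
          obtain ⟨hu1, -, -⟩ := Finset.mem_filter.1 hu
          obtain ⟨hu2, hu3⟩ := Finset.mem_filter.1 hu1
          rw [Finset.mem_Icc] at hu2
          rw [Finset.mem_union] at hu'
          rcases hu' with h | h
          · exact h
          · exfalso
            rw [Finset.mem_Icc] at h
            have : u ≤ P := hu2.2
            have hu4 : u ≠ P := fun he => hu3 (by rw [he, abs_of_nonneg (by linarith)])
            have : u < P := lt_of_le_of_ne this hu4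
            linarith [h.1]
        exact_mod_cast (Finset.card_le_card hT').trans hc1.le
      · push Not at ht0
        rw [abs_of_neg ht0] at hf
        have hT' : T ⊆ Finset.Icc (t + L₀ + 1) (t + L₀ + r) := by
          intro u hu
          have hu' := hTsub hu
          obtain ⟨hu1, -, -⟩ := Finset.mem_filter.1 hu
          obtain ⟨hu2, hu3⟩ := Finset.mem_filter.1 hu1
          rw [Finset.mem_Icc] at hu2
          rw [Finset.mem_union] at hu'
          rcases hu' with h | h
          · exfalso
            rw [Finset.mem_Icc] at h
            have : -P ≤ u := hu2.1
            have hu4 : u ≠ -P := fun he => hu3 (by rw [he, abs_neg, abs_of_nonneg (by linarith)])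
            have : -P < u := lt_of_le_of_ne this (Ne.symm hu4)
            linarith [h.2]
          · exact h
        exact_mod_cast (Finset.card_le_card hT').trans hc2.le
    · calc (T.card : ℝ) ≤ ((Finset.Icc (t - L₀ - r) (t - L₀ - 1) ∪ Finset.Icc (t + L₀ + 1) (t + L₀ + r)).card : ℕ) := by
            exact_mod_cast Finset.card_le_card hTsub
        _ ≤ ((Finset.Icc (t - L₀ - r) (t - L₀ - 1)).card + (Finset.Icc (t + L₀ + 1) (t + L₀ + r)).card : ℕ) := by
            exact_mod_cast Finset.card_union_le _ _
        _ = 2 * r := by rw [hc1, hc2]; push_cast; ring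
  refine (add_le_add hface hint).trans ?_
  split_ifs <;> linarith

omit [MeasurableSpace S] [MeasurableSingletonClass S] [Fintype S] [Nonempty S] [DecidableEq S] in
/-- **Per-coordinate domination**: `near1 − cov1 ≤ η · cov1` on `|t| ≤ P + L₀` as soon as `r ≤ ηW` and
`W + 2r ≤ η(2L₀ + 1)` (`W ≥ 1`, `P ≥ L₀ + r + 1`). [folklore] -/
private theorem near1_sub_cov1_le_mul {P : ℤ} {L₀ r : ℕ} {W η : ℝ} (hW : 1 ≤ W) (hP : (L₀ : ℤ) + r + 1 ≤ P)
    (hη1 : (r : ℝ) ≤ η * W) (hη2 : W + 2 * r ≤ η * (2 * L₀ + 1)) {t : ℤ} (ht : |t| ≤ P + L₀) :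
    near1 P L₀ r W t - cov1 P L₀ W t ≤ η * cov1 P L₀ W t := by
  have hη0 : 0 ≤ η := by
    by_contra h; push Not at h
    have : η * W < 0 := mul_neg_of_neg_of_pos h (by linarith)
    linarith [Nat.cast_nonneg (α := ℝ) r]
  refine (near1_sub_cov1_le hW hP ht).trans ?_
  split_ifs with hf
  · exact hη1.trans (mul_le_mul_of_nonneg_left (cov1_ge_W (by linarith) (by linarith) ht hf) hη0)
  · push Not at hf
    exact hη2.trans (mul_le_mul_of_nonneg_left (cov1_ge_bulk hW hf) hη0)

omit [MeasurableSpace S] [MeasurableSingletonClass S] [Fintype S] [Nonempty S] [DecidableEq S] in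
/-- `cov1 ≥ 1` on `|t| ≤ P + L₀` (`W ≥ 1`, `P ≥ L₀`). [folklore] -/
private theorem one_le_cov1 {P : ℤ} {L₀ : ℕ} {W : ℝ} (hW : 1 ≤ W) (hP : (L₀ : ℤ) ≤ P) {t : ℤ} (ht : |t| ≤ P + L₀) :
    1 ≤ cov1 P L₀ W t := by
  by_cases hf : P - L₀ ≤ |t|
  · exact hW.trans (cov1_ge_W (by linarith) (by linarith [Nat.cast_nonneg (α := ℤ) L₀]) ht hf)
  · push Not at hf
    refine le_trans ?_ (cov1_ge_bulk hW hf)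
    have := Nat.cast_nonneg (α := ℝ) L₀
    linarith

omit [MeasurableSpace S] [MeasurableSingletonClass S] [Fintype S] [Nonempty S] [DecidableEq S] in
/-- `near1 ≤ (2(L₀+r)+1) W` (at most `2(L₀+r)+1` positions, each of weight `≤ W`). [folklore] -/
private theorem near1_le {P : ℤ} {L₀ r : ℕ} {W : ℝ} (hW : 1 ≤ W) (t : ℤ) :
    near1 P L₀ r W t ≤ (2 * (L₀ + r) + 1) * W := by
  unfold near1
  have hW0 : 0 ≤ W := by linarith
  calc ∑ u ∈ Finset.Icc (-P) P, ω1 P W u * (if |t - u| ≤ (L₀ : ℤ) + r then 1 else 0)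
      ≤ ∑ u ∈ Finset.Icc (-P) P, (if u ∈ Finset.Icc (t - L₀ - r) (t + L₀ + r) then W else 0) := by
        refine Finset.sum_le_sum fun u _ => ?_
        split_ifs with h1 h2
        · rw [mul_one]; exact ω1_le hW u
        · exfalso; apply h2; rw [Finset.mem_Icc]; have := abs_le.1 h1; constructor <;> linarith
        · rw [mul_zero]; exact hW0
        · rw [mul_zero]
    _ = ((Finset.Icc (-P) P).filter (fun u => u ∈ Finset.Icc (t - L₀ - r) (t + L₀ + r))).card * W := by
        rw [← Finset.sum_filter, Finset.sum_const, nsmul_eq_mul]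
    _ ≤ (2 * (L₀ + r) + 1) * W := by
        refine mul_le_mul_of_nonneg_right ?_ hW0
        have h1 : ((Finset.Icc (-P) P).filter (fun u => u ∈ Finset.Icc (t - L₀ - r) (t + L₀ + r))).card ≤
            (Finset.Icc (t - L₀ - r) (t + L₀ + r)).card :=
          Finset.card_le_card fun u hu => (Finset.mem_filter.1 hu).2
        rw [Int.card_Icc] at h1
        have h2 : (t + ↑L₀ + ↑r + 1 - (t - ↑L₀ - ↑r)).toNat = 2 * (L₀ + r) + 1 := by
          have : t + ↑L₀ + ↑r + 1 - (t - ↑L₀ - ↑r) = ((2 * (L₀ + r) + 1 : ℕ) : ℤ) := by push_cast; ring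
          rw [this, Int.toNat_natCast]
        rw [h2] at h1
        exact_mod_cast h1

omit [MeasurableSpace S] [MeasurableSingletonClass S] [Fintype S] [Nonempty S] [DecidableEq S] in
/-- Outside `Λ_L` in coordinate `t` (`|t| > P + L₀`): `near1 t ≤ W + r` (only the face position and the at
most `r` positions beyond it are within `L₀ + r`; `P ≥ L₀ + r + 1`, `W ≥ 1`). [folklore] -/
private theorem near1_le_of_out {P : ℤ} {L₀ r : ℕ} {W : ℝ} (hW : 1 ≤ W) (hP : (L₀ : ℤ) + r + 1 ≤ P) {t : ℤ}
    (ht : P + L₀ < |t|) : near1 P L₀ r W t ≤ W + r := by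
  unfold near1
  have hW0 : 0 ≤ W := by linarith
  rw [(Finset.sum_filter_add_sum_filter_not (Finset.Icc (-P) P) (fun u => |u| = P) _).symm]
  refine add_le_add ?_ ?_
  · -- faces: the far one is out of reach
    by_cases ht0 : 0 ≤ t
    · rw [abs_of_nonneg ht0] at ht
      calc ∑ u ∈ (Finset.Icc (-P) P).filter (fun u => |u| = P), ω1 P W u * (if |t - u| ≤ (L₀ : ℤ) + r then 1 else 0)
          ≤ ∑ u ∈ (Finset.Icc (-P) P).filter (fun u => |u| = P), (if u = P then W else 0) := by
            refine Finset.sum_le_sum fun u hu => ?_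
            obtain ⟨hu1, hu2⟩ := Finset.mem_filter.1 hu
            by_cases huP : u = P
            · rw [if_pos huP]; split_ifs
              · rw [mul_one]; exact ω1_le hW u
              · rw [mul_zero]; exact hW0
            · have : u = -P := by
                rcases (abs_eq (by linarith : (0:ℤ) ≤ P)).1 hu2 with h | h
                · exact absurd h huP
                · exact h
              rw [if_neg huP, if_neg, mul_zero]
              rw [this, sub_neg_eq_add, abs_of_nonneg (by linarith)]
              linarith
        _ ≤ W := by
            rw [Finset.sum_ite_eq']
            split_ifs
            · exact le_rfl
            · exact hW0
    · push Not at ht0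
      rw [abs_of_neg ht0] at ht
      calc ∑ u ∈ (Finset.Icc (-P) P).filter (fun u => |u| = P), ω1 P W u * (if |t - u| ≤ (L₀ : ℤ) + r then 1 else 0)
          ≤ ∑ u ∈ (Finset.Icc (-P) P).filter (fun u => |u| = P), (if u = -P then W else 0) := by
            refine Finset.sum_le_sum fun u hu => ?_
            obtain ⟨hu1, hu2⟩ := Finset.mem_filter.1 hu
            by_cases huP : u = -P
            · rw [if_pos huP]; split_ifs
              · rw [mul_one]; exact ω1_le hW u
              · rw [mul_zero]; exact hW0
            · have : u = P := by
                rcases (abs_eq (by linarith : (0:ℤ) ≤ P)).1 hu2 with h | h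
                · exact h
                · exact absurd h huP
              rw [if_neg huP, if_neg, mul_zero]
              rw [this, abs_sub_comm, abs_of_nonneg (by linarith)]
              linarith
        _ ≤ W := by
            rw [Finset.sum_ite_eq']
            split_ifs
            · exact le_rfl
            · exact hW0
  · -- interior: positions within `L₀ + r` of `t` with `|u| < P` lie in an interval of length `≤ r`
    have h1 : ∑ u ∈ (Finset.Icc (-P) P).filter (fun u => ¬ |u| = P),
        ω1 P W u * (if |t - u| ≤ (L₀ : ℤ) + r then 1 else 0) =
        (((Finset.Icc (-P) P).filter (fun u => ¬ |u| = P)).filter (fun u => |t - u| ≤ (L₀ : ℤ) + r)).card := by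
      rw [← Finset.sum_boole]
      refine Finset.sum_congr rfl fun u hu => ?_
      have hω : ω1 P W u = 1 := by unfold ω1; rw [if_neg (Finset.mem_filter.1 hu).2]
      rw [hω, one_mul]
    rw [h1]
    by_cases ht0 : 0 ≤ t
    · rw [abs_of_nonneg ht0] at ht
      have hsub : ((Finset.Icc (-P) P).filter (fun u => ¬ |u| = P)).filter (fun u => |t - u| ≤ (L₀ : ℤ) + r) ⊆
          Finset.Icc (t - L₀ - r) (P - 1) := by
        intro u hu
        obtain ⟨hu1, hu2⟩ := Finset.mem_filter.1 hu
        obtain ⟨hu3, hu4⟩ := Finset.mem_filter.1 hu1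
        rw [Finset.mem_Icc] at hu3 ⊢
        have := abs_le.1 hu2
        have hu5 : u ≠ P := fun he => hu4 (by rw [he, abs_of_nonneg (by linarith)])
        constructor
        · linarith
        · have : u < P := lt_of_le_of_ne hu3.2 hu5; linarith
      calc ((((Finset.Icc (-P) P).filter (fun u => ¬ |u| = P)).filter (fun u => |t - u| ≤ (L₀ : ℤ) + r)).card : ℝ)
          ≤ (Finset.Icc (t - L₀ - r) (P - 1)).card := by exact_mod_cast Finset.card_le_card hsub
        _ ≤ r := by
            rw [Int.card_Icc]
            have : (P - 1 + 1 - (t - ↑L₀ - ↑r)).toNat ≤ r := by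
              have : P - 1 + 1 - (t - ↑L₀ - ↑r) ≤ r := by linarith
              omega
            exact_mod_cast this
    · push Not at ht0
      rw [abs_of_neg ht0] at ht
      have hsub : ((Finset.Icc (-P) P).filter (fun u => ¬ |u| = P)).filter (fun u => |t - u| ≤ (L₀ : ℤ) + r) ⊆
          Finset.Icc (-P + 1) (t + L₀ + r) := by
        intro u hu
        obtain ⟨hu1, hu2⟩ := Finset.mem_filter.1 hu
        obtain ⟨hu3, hu4⟩ := Finset.mem_filter.1 hu1
        rw [Finset.mem_Icc] at hu3 ⊢
        have := abs_le.1 hu2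
        have hu5 : u ≠ -P := fun he => hu4 (by rw [he, abs_neg, abs_of_nonneg (by linarith)])
        constructor
        · have : -P < u := lt_of_le_of_ne hu3.1 (Ne.symm hu5); linarith
        · linarith
      calc ((((Finset.Icc (-P) P).filter (fun u => ¬ |u| = P)).filter (fun u => |t - u| ≤ (L₀ : ℤ) + r)).card : ℝ)
          ≤ (Finset.Icc (-P + 1) (t + L₀ + r)).card := by exact_mod_cast Finset.card_le_card hsub
        _ ≤ r := by
            rw [Int.card_Icc]
            have : (t + ↑L₀ + ↑r + 1 - (-P + 1)).toNat ≤ r := by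
              have : t + ↑L₀ + ↑r + 1 - (-P + 1) ≤ r := by linarith
              omega
            exact_mod_cast this

/-! ### The block family of the square and the covering condition -/

/-- The admissible positions `|u_k| ≤ P` (`P = L − L₀`: all translates of `Λ_{L₀}` inside `Λ_L`).
[cite: MartinelliOlivieriSchonmann1994, Theorem 2.1 (block dynamics of [MO1])] -/
def posSet (P : ℤ) : Finset (Site 2) := Fintype.piFinset fun _ : Fin 2 => Finset.Icc (-P) P

/-- The product weight `ω(u) = ω₁(u₀) ω₁(u₁)`. [folklore] -/
def ω (P : ℤ) (W : ℝ) (u : Site 2) : ℝ := ∏ k, ω1 P W (u k)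

/-- The normalisation `Z = Σ_u ω(u)`. [folklore] -/
def Z (P : ℤ) (W : ℝ) : ℝ := ∑ u ∈ posSet P, ω P W u

/-- The block distribution `π(u) = ω(u)/Z` on the positions. [folklore] -/
def πw (P : ℤ) (W : ℝ) (u : ↥(posSet P)) : ℝ := ω P W u / Z P W

omit [MeasurableSpace S] [MeasurableSingletonClass S] [Fintype S] [Nonempty S] [DecidableEq S] in
/-- Membership in the position set. [folklore] -/
private theorem mem_posSet {P : ℤ} {u : Site 2} : u ∈ posSet P ↔ ∀ k, |u k| ≤ P := by
  simp only [posSet, Fintype.mem_piFinset, Finset.mem_Icc, abs_le]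

omit [MeasurableSpace S] [MeasurableSingletonClass S] [Fintype S] [Nonempty S] [DecidableEq S] in
/-- `ω ≥ 0`. [folklore] -/
private theorem ω_nonneg {P : ℤ} {W : ℝ} (hW : 0 ≤ W) (u : Site 2) : 0 ≤ ω P W u :=
  Finset.prod_nonneg fun k _ => ω1_nonneg hW (u k)

omit [MeasurableSpace S] [MeasurableSingletonClass S] [Fintype S] [Nonempty S] [DecidableEq S] in
/-- `Z = ∏_k Σ_j ω₁(j)`. [folklore] -/
private theorem Z_eq (P : ℤ) (W : ℝ) : Z P W = ∏ _k : Fin 2, ∑ j ∈ Finset.Icc (-P) P, ω1 P W j := by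
  unfold Z ω posSet
  exact Finset.sum_prod_piFinset _ (fun _ j => ω1 P W j)

omit [MeasurableSpace S] [MeasurableSingletonClass S] [Fintype S] [Nonempty S] [DecidableEq S] in
/-- `Z ≥ 1` for `W ≥ 1`, `P ≥ 0`. [folklore] -/
private theorem one_le_Z {P : ℤ} {W : ℝ} (hW : 1 ≤ W) (hP : 0 ≤ P) : 1 ≤ Z P W := by
  rw [Z_eq]
  have h1 : ∀ k ∈ (Finset.univ : Finset (Fin 2)), (1 : ℝ) ≤ ∑ j ∈ Finset.Icc (-P) P, ω1 P W j := by
    intro k _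
    have h0 : (0 : ℤ) ∈ Finset.Icc (-P) P := by rw [Finset.mem_Icc]; constructor <;> linarith
    exact (one_le_ω1 hW 0).trans
      (Finset.single_le_sum (fun j _ => ω1_nonneg (by linarith) j) h0)
  calc (1 : ℝ) = ∏ _k : Fin 2, (1 : ℝ) := by simp
    _ ≤ _ := Finset.prod_le_prod (fun _ _ => zero_le_one) h1

omit [MeasurableSpace S] [MeasurableSingletonClass S] [Fintype S] [Nonempty S] [DecidableEq S] in
/-- `Σ_i π(i) = 1`. [folklore] -/
private theorem sum_πw {P : ℤ} {W : ℝ} (hZ : Z P W ≠ 0) : ∑ i : ↥(posSet P), πw P W i = 1 := by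
  have h : ∑ i : ↥(posSet P), πw P W i = ∑ u ∈ posSet P, ω P W u / Z P W :=
    Finset.sum_coe_sort (posSet P) (fun u => ω P W u / Z P W)
  rw [h, ← Finset.sum_div]
  exact div_self hZ

omit [MeasurableSpace S] [MeasurableSingletonClass S] [Fintype S] [Nonempty S] [DecidableEq S] in
/-- **Coverage factorises**: `covP(z) = cov₁(z₀) cov₁(z₁) / Z`. [folklore] -/
private theorem covP_eq {P : ℤ} {L₀ : ℕ} {W : ℝ} (z : Site 2) :
    covP (B := fun i : ↥(posSet P) => blk L₀ (i : Site 2)) (π := πw P W) z =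
      (∏ k, cov1 P L₀ W (z k)) / Z P W := by
  unfold covP
  have h : ∑ i : ↥(posSet P), πw P W i * (if z ∈ blk L₀ (i : Site 2) then (1 : ℝ) else 0) =
      ∑ u ∈ posSet P, ω P W u / Z P W * (if z ∈ blk L₀ u then (1 : ℝ) else 0) :=
    Finset.sum_coe_sort (posSet P) (fun u => ω P W u / Z P W * (if z ∈ blk L₀ u then (1 : ℝ) else 0))
  rw [h]
  have h2 : ∀ u, ω P W u / Z P W * (if z ∈ blk L₀ u then (1 : ℝ) else 0) =
      (∏ k, (ω1 P W (u k) * (if |z k - u k| ≤ (L₀ : ℤ) then (1 : ℝ) else 0))) / Z P W := by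
    intro u
    by_cases hz : z ∈ blk L₀ u
    · have hk : ∀ k, |z k - u k| ≤ (L₀ : ℤ) := mem_blk.1 hz
      rw [if_pos hz, mul_one, Finset.prod_congr rfl (fun k _ => by rw [if_pos (hk k), mul_one])]
      rfl
    · have hk : ¬ ∀ k, |z k - u k| ≤ (L₀ : ℤ) := fun h => hz (mem_blk.2 h)
      push Not at hk
      obtain ⟨k, hk⟩ := hk
      rw [if_neg hz, mul_zero, Finset.prod_eq_zero (Finset.mem_univ k) (by rw [if_neg (not_le.2 hk), mul_zero]),
        zero_div]
  simp_rw [h2]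
  rw [← Finset.sum_div]
  congr 1
  unfold posSet cov1
  exact Finset.sum_prod_piFinset _ (fun k j => ω1 P W j * (if |z k - j| ≤ (L₀ : ℤ) then (1 : ℝ) else 0))

omit [MeasurableSpace S] [MeasurableSingletonClass S] [Fintype S] [Nonempty S] [DecidableEq S] in
/-- **The boundary-hit probability is dominated by the product difference**:
`bdP(z) ≤ (near₁(z₀) near₁(z₁) − cov₁(z₀) cov₁(z₁)) / Z`. [folklore] -/
private theorem bdP_le {P : ℤ} {L₀ : ℕ} {W : ℝ} (hW : 0 ≤ W) (hZ : 0 < Z P W) (z : Site 2) :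
    bdP (r := r) (B := fun i : ↥(posSet P) => blk L₀ (i : Site 2)) (π := πw P W) z ≤
      ((∏ k, near1 P L₀ r W (z k)) - ∏ k, cov1 P L₀ W (z k)) / Z P W := by
  unfold bdP
  have h : ∑ i : ↥(posSet P), πw P W i * (if z ∈ rOuterBoundary r (blk L₀ (i : Site 2)) then (1 : ℝ) else 0) =
      ∑ u ∈ posSet P, ω P W u / Z P W * (if z ∈ rOuterBoundary r (blk L₀ u) then (1 : ℝ) else 0) :=
    Finset.sum_coe_sort (posSet P)
      (fun u => ω P W u / Z P W * (if z ∈ rOuterBoundary r (blk L₀ u) then (1 : ℝ) else 0))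
  rw [h]
  -- pointwise: `1{z ∈ ∂B_u} ≤ 1{near} − 1{in}`
  have hpt : ∀ u, ω P W u / Z P W * (if z ∈ rOuterBoundary r (blk L₀ u) then (1 : ℝ) else 0) ≤
      ((∏ k, (ω1 P W (u k) * (if |z k - u k| ≤ (L₀ : ℤ) + r then (1 : ℝ) else 0))) -
        ∏ k, (ω1 P W (u k) * (if |z k - u k| ≤ (L₀ : ℤ) then (1 : ℝ) else 0))) / Z P W := by
    intro u
    set N := ∏ k, (ω1 P W (u k) * (if |z k - u k| ≤ (L₀ : ℤ) + r then (1 : ℝ) else 0)) with hN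
    set Cv := ∏ k, (ω1 P W (u k) * (if |z k - u k| ≤ (L₀ : ℤ) then (1 : ℝ) else 0)) with hCv
    have hCvN : Cv ≤ N := by
      refine Finset.prod_le_prod (fun k _ => mul_nonneg (ω1_nonneg hW _) (by split_ifs <;> norm_num))
        fun k _ => mul_le_mul_of_nonneg_left ?_ (ω1_nonneg hW _)
      split_ifs with h1 h2
      · exact le_rfl
      · exact absurd (h1.trans (by linarith)) h2
      · norm_num
      · exact le_rfl
    by_cases hzb : z ∈ rOuterBoundary r (blk L₀ u)
    · obtain ⟨hnot, hnear⟩ := abs_le_of_mem_rOuterBoundary_blk hzb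
      have hNe : N = ω P W u := by
        rw [hN, Finset.prod_congr rfl (fun k _ => by rw [if_pos (hnear k), mul_one])]
        rfl
      have hk : ¬ ∀ k, |z k - u k| ≤ (L₀ : ℤ) := fun h => hnot (mem_blk.2 h)
      push Not at hk
      obtain ⟨k, hk⟩ := hk
      have hCe : Cv = 0 := by
        rw [hCv]
        exact Finset.prod_eq_zero (Finset.mem_univ k) (by rw [if_neg (not_le.2 hk), mul_zero])
      rw [if_pos hzb, mul_one, hNe, hCe, sub_zero]
    · rw [if_neg hzb, mul_zero]
      exact div_nonneg (by linarith) hZ.le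
  refine (Finset.sum_le_sum fun u _ => hpt u).trans_eq ?_
  rw [← Finset.sum_div, Finset.sum_sub_distrib]
  congr 1
  unfold posSet near1 cov1
  rw [Finset.sum_prod_piFinset _ (fun k j => ω1 P W j * (if |z k - j| ≤ (L₀ : ℤ) + r then (1 : ℝ) else 0)),
    Finset.sum_prod_piFinset _ (fun k j => ω1 P W j * (if |z k - j| ≤ (L₀ : ℤ) then (1 : ℝ) else 0))]

omit [MeasurableSpace S] [MeasurableSingletonClass S] [Fintype S] [Nonempty S] [DecidableEq S] in
/-- **The covering condition for the square**: with `η`-domination per coordinate (`r ≤ ηW`,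
`W + 2r ≤ η(2L₀+1)`) and `A(2η + η²) ≤ 1/2`, every site of `Λ_L` satisfies
`A · bdP(z) + 1/(2Z) ≤ covP(z)`. [cite: MartinelliOlivieriSchonmann1994, Theorem 1.1 (proof)] -/
private theorem covering {P : ℤ} {L₀ : ℕ} {W η A : ℝ} (hW : 1 ≤ W) (hP : (L₀ : ℤ) + r + 1 ≤ P)
    (hη0 : 0 ≤ η) (hη1 : (r : ℝ) ≤ η * W) (hη2 : W + 2 * r ≤ η * (2 * L₀ + 1)) (hA0 : 0 ≤ A)
    (hA : A * (2 * η + η ^ 2) ≤ 1 / 2) {z : Site 2} (hz : ∀ k, |z k| ≤ P + L₀) :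
    A * bdP (r := r) (B := fun i : ↥(posSet P) => blk L₀ (i : Site 2)) (π := πw P W) z + 1 / (2 * Z P W) ≤
      covP (B := fun i : ↥(posSet P) => blk L₀ (i : Site 2)) (π := πw P W) z := by
  have hZ1 : 1 ≤ Z P W := one_le_Z hW (by linarith)
  have hZ : 0 < Z P W := by linarith
  rw [covP_eq, Fin.prod_univ_two]
  refine le_trans (add_le_add (mul_le_mul_of_nonneg_left (bdP_le (r := r) (by linarith) hZ z) hA0) le_rfl) ?_
  rw [Fin.prod_univ_two, Fin.prod_univ_two]
  set c0 := cov1 P L₀ W (z 0)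
  set c1 := cov1 P L₀ W (z 1)
  set n0 := near1 P L₀ r W (z 0)
  set n1 := near1 P L₀ r W (z 1)
  have hc0 : 1 ≤ c0 := one_le_cov1 hW (by linarith) (hz 0)
  have hc1 : 1 ≤ c1 := one_le_cov1 hW (by linarith) (hz 1)
  have hn0 : n0 - c0 ≤ η * c0 := near1_sub_cov1_le_mul hW hP hη1 hη2 (hz 0)
  have hn1 : n1 - c1 ≤ η * c1 := near1_sub_cov1_le_mul hW hP hη1 hη2 (hz 1)
  have hcn0 : c0 ≤ n0 := cov1_le_near1 P L₀ r (by linarith) (z 0)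
  have hcn1 : c1 ≤ n1 := cov1_le_near1 P L₀ r (by linarith) (z 1)
  -- `n0 n1 − c0 c1 ≤ (2η + η²) c0 c1`
  have hkey : n0 * n1 - c0 * c1 ≤ (2 * η + η ^ 2) * (c0 * c1) := by
    have e1 : n0 ≤ (1 + η) * c0 := by linarith
    have e2 : n1 ≤ (1 + η) * c1 := by linarith
    have := mul_le_mul e1 e2 (by linarith) (by positivity)
    nlinarith
  have hcc : 1 ≤ c0 * c1 := by nlinarith
  have h3 : A * (n0 * n1 - c0 * c1) ≤ (c0 * c1) / 2 := by
    calc A * (n0 * n1 - c0 * c1) ≤ A * ((2 * η + η ^ 2) * (c0 * c1)) := mul_le_mul_of_nonneg_left hkey hA0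
      _ = A * (2 * η + η ^ 2) * (c0 * c1) := by ring
      _ ≤ 1 / 2 * (c0 * c1) := mul_le_mul_of_nonneg_right hA (by positivity)
      _ = (c0 * c1) / 2 := by ring
  have e : A * ((n0 * n1 - c0 * c1) / Z P W) + 1 / (2 * Z P W) = (A * (n0 * n1 - c0 * c1) + 1 / 2) / Z P W := by
    field_simp
  rw [e, div_le_div_iff_of_pos_right hZ]
  linarith [h3, hcc]

/-! ### The constants -/

omit [MeasurableSpace S] [MeasurableSingletonClass S] [Fintype S] [Nonempty S] [DecidableEq S] in
/-- `A q^k e^{−cq} ≤ ε` for all large natural `q` (from `x^k e^{−x} → 0`). [folklore] -/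
private theorem exists_nat_pow_mul_exp_le' (A : ℝ) {c ε : ℝ} (hc : 0 < c) (hε : 0 < ε) (k : ℕ) :
    ∃ N : ℕ, ∀ q : ℕ, N ≤ q → A * (q : ℝ) ^ k * Real.exp (-(c * q)) ≤ ε := by
  have h1 : Tendsto (fun x : ℝ => x ^ k * Real.exp (-x)) atTop (nhds 0) :=
    Real.tendsto_pow_mul_exp_neg_atTop_nhds_zero k
  have h2 : Tendsto (fun q : ℕ => c * (q : ℝ)) atTop atTop :=
    (tendsto_natCast_atTop_atTop).const_mul_atTop hc
  have h3 := (h1.comp h2).const_mul (A / c ^ k)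
  rw [mul_zero] at h3
  have h4 : ∀ q : ℕ, A / c ^ k * ((fun x : ℝ => x ^ k * Real.exp (-x)) ∘ fun q : ℕ => c * (q : ℝ)) q =
      A * (q : ℝ) ^ k * Real.exp (-(c * q)) := by
    intro q
    simp only [Function.comp, mul_pow]
    field_simp
  obtain ⟨N, hN⟩ := Filter.eventually_atTop.1 (h3.eventually (Iic_mem_nhds hε))
  exact ⟨N, fun q hq => by rw [← h4 q]; exact hN q hq⟩

/-- The face weight `W = 168 q⁴ r + 1`. [folklore] -/
def Wc (r q : ℕ) : ℕ := 168 * q ^ 4 * r + 1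

/-- The block parameter `L₀ = 84 q⁴ (168 q⁴ r + 2r + 1)`. [folklore] -/
def L0c (r q : ℕ) : ℕ := 84 * q ^ 4 * (168 * q ^ 4 * r + 2 * r + 1)

omit [MeasurableSpace S] [MeasurableSingletonClass S] [Fintype S] [Nonempty S] [DecidableEq S] in
/-- `q⁴ ≤ L₀`. [folklore] -/
private theorem pow_le_L0c (r q : ℕ) : q ^ 4 ≤ L0c r q := by
  unfold L0c
  calc q ^ 4 = 1 * q ^ 4 * 1 := by ring
    _ ≤ 84 * q ^ 4 * (168 * q ^ 4 * r + 2 * r + 1) :=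
        Nat.mul_le_mul (Nat.mul_le_mul (by norm_num) le_rfl) (by omega)

omit [MeasurableSpace S] [MeasurableSingletonClass S] [Fintype S] [Nonempty S] [DecidableEq S] in
/-- `2L₀ + 1 ≤ K q⁸` with `K = 28560 r + 169` (`q ≥ 1`). [folklore] -/
private theorem two_L0c_le {r q : ℕ} (hq : 1 ≤ q) : (2 * (L0c r q : ℝ) + 1) ≤ (28560 * r + 169) * (q : ℝ) ^ 8 := by
  unfold L0c
  push_cast
  have hx : (1 : ℝ) ≤ q := by exact_mod_cast hq
  have h4 : (1 : ℝ) ≤ (q : ℝ) ^ 4 := one_le_pow₀ hx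
  have h8 : (q : ℝ) ^ 4 ≤ (q : ℝ) ^ 8 := by
    calc (q : ℝ) ^ 4 = (q : ℝ) ^ 4 * 1 := (mul_one _).symm
      _ ≤ (q : ℝ) ^ 4 * (q : ℝ) ^ 4 := mul_le_mul_of_nonneg_left h4 (by positivity)
      _ = (q : ℝ) ^ 8 := by ring
  have hr : (0 : ℝ) ≤ r := Nat.cast_nonneg r
  have e : 2 * (84 * (q : ℝ) ^ 4 * (168 * (q : ℝ) ^ 4 * r + 2 * r + 1)) + 1 =
      28224 * r * (q : ℝ) ^ 8 + (336 * r + 168) * (q : ℝ) ^ 4 + 1 := by ring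
  rw [e]
  nlinarith [mul_le_mul_of_nonneg_left h8 (by positivity : (0 : ℝ) ≤ 336 * r + 168), h4.trans h8]

omit [MeasurableSpace S] [MeasurableSingletonClass S] [Fintype S] [Nonempty S] [DecidableEq S] in
/-- **Choice of the scale `q`**: beyond the threshold `Q` of (2.1), `q ≥ 3`, and with
`3 (2L₀+1)² (1 − δ₀)^{q−3} ≤ 1` (super-polynomial smallness of (2.1) against the polynomial block volume).
[folklore] -/
private theorem exists_scale (r : ℕ) {δ₀ : ℝ} (hδ0 : 0 < δ₀) (hδ1 : δ₀ ≤ 1) (Q : ℕ) :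
    ∃ q : ℕ, Q ≤ q ∧ 3 ≤ q ∧ 3 * (2 * (L0c r q : ℝ) + 1) ^ 2 * (1 - δ₀) ^ (q - 3) ≤ 1 := by
  set K : ℝ := 28560 * r + 169 with hK
  obtain ⟨N, hN⟩ := exists_nat_pow_mul_exp_le' (3 * K ^ 2 * Real.exp (3 * δ₀)) hδ0 one_pos 16
  refine ⟨max (max Q 3) N, le_trans (le_max_left _ _) (le_max_left _ _),
    le_trans (le_max_right _ _) (le_max_left _ _), ?_⟩
  set q := max (max Q 3) N with hq
  have hq3 : 3 ≤ q := le_trans (le_max_right _ _) (le_max_left _ _)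
  have hqN : N ≤ q := le_max_right _ _
  have hq1 : 1 ≤ q := by omega
  have h1 := two_L0c_le (r := r) hq1
  have h2 : (1 - δ₀) ^ (q - 3) ≤ Real.exp (3 * δ₀) * Real.exp (-(δ₀ * q)) := by
    have e1 : (1 - δ₀) ^ (q - 3) ≤ Real.exp (-δ₀) ^ (q - 3) :=
      pow_le_pow_left₀ (by linarith) (by linarith [Real.add_one_le_exp (-δ₀)]) _
    refine e1.trans ?_
    rw [← Real.exp_nat_mul, ← Real.exp_add, Real.exp_le_exp, Nat.cast_sub hq3]
    push_cast
    nlinarith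
  have h3 := hN q hqN
  have h0 : 0 ≤ 2 * (L0c r q : ℝ) + 1 := by positivity
  calc 3 * (2 * (L0c r q : ℝ) + 1) ^ 2 * (1 - δ₀) ^ (q - 3)
      ≤ 3 * (K * (q : ℝ) ^ 8) ^ 2 * (Real.exp (3 * δ₀) * Real.exp (-(δ₀ * q))) :=
        mul_le_mul (mul_le_mul_of_nonneg_left (pow_le_pow_left₀ h0 h1 2) (by norm_num)) h2
          (pow_nonneg (by linarith) _) (by positivity)
    _ = 3 * K ^ 2 * Real.exp (3 * δ₀) * (q : ℝ) ^ 16 * Real.exp (-(δ₀ * q)) := by ring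
    _ ≤ 1 := h3

/-! ### [MOS94] Theorem 1.1 -/

omit [MeasurableSpace S] [MeasurableSingletonClass S] [Fintype S] [Nonempty S] [DecidableEq S] in
/-- Sites of the square and a site within `r` of it are within `2L + r`. [folklore] -/
private theorem supDist_le_of_mem_centeredCube {L : ℕ} {x y : Site 2} (hx : x ∈ centeredCube 2 L)
    (hy : ∀ j, (y j).natAbs ≤ L + r) : supDist x y ≤ 2 * L + r := by
  rw [supDist_le_iff]
  intro j
  have h1 := (mem_centeredCube.1 hx) j
  have h2 := hy j
  omega

set_option maxHeartbeats 800000 in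
/-- **A finite-size condition on ONE square implies strong mixing on ALL squares** ([MOS94] Theorem 2.1 =
[MO1] Thm 4.1 + Prop 4.1, here with the (2.1)-type input and proved by the block coupling of
`WeakMixingBlockCoupling`): if for some scale `q ≥ 1` and some `L₀ ≥ L0c r q` the kernels of the square
`Λ_{L₀}` satisfy `|μ_{Λ_{L₀}}^τ(E) − μ_{Λ_{L₀}}^{τ′}(E)| ≤ ε · #{z ∈ ∂_r^+Λ_{L₀} : τ z ≠ τ′ z}` for all `τ, τ′`
and all events `E` of the spins at distance `≥ q²` from those sites, with `3 (2L₀+1)² ε ≤ 1`, then there is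
`C′ > 0` such that `SM(Λ_L, C′, m)` holds for EVERY square `Λ_L`, `m = 1/(q² + 2L₀ + r + 1)` (large squares:
the block coupling with all translates of `Λ_{L₀}` as blocks; small squares: the trivial bound).
[cite: MartinelliOlivieriSchonmann1994, Theorem 2.1] -/
theorem strongMixing_of_finiteSize (U : FRPotential 2 S r) (β : ℝ) {q L₀ : ℕ} (hq1 : 1 ≤ q)
    (hL₀c : L0c r q ≤ L₀) {ε : ℝ} (hε0 : 0 ≤ ε) (hsmall : 3 * (2 * (L₀ : ℝ) + 1) ^ 2 * ε ≤ 1)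
    (hFS : ∀ (τ τ' : Site 2 → S) (E : Set (Site 2 → S)), MeasurableSet E →
      DependsOn (· ∈ E) {x | x ∈ centeredCube 2 L₀ ∧
        ∀ z ∈ rOuterBoundary r (centeredCube 2 L₀), τ z ≠ τ' z → q ^ 2 ≤ supDist x z} →
      |(U.spec β (centeredCube 2 L₀) τ).real E - (U.spec β (centeredCube 2 L₀) τ').real E| ≤
        ((rOuterBoundary r (centeredCube 2 L₀)).filter (fun z => τ z ≠ τ' z)).card * ε) :
    ∃ C' : ℝ, 0 < C' ∧
      ∀ L : ℕ, StrongMixing (U.spec β) (centeredCube 2 L) C' (1 / ((q : ℝ) ^ 2 + (2 * L₀ + r : ℕ) + 1)) := by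
  -- the constants
  set W : ℝ := (Wc r q : ℝ) with hWdef
  set V : ℕ := (2 * L₀ + 1) ^ 2 with hV
  set Dm : ℕ := 2 * L₀ + r with hDm
  set m : ℝ := 1 / ((q : ℝ) ^ 2 + Dm + 1) with hm
  set A : ℝ := Acst 2 (q ^ 2) m ε V Dm with hA
  set A₀ : ℝ := 28 * (q : ℝ) ^ 4 with hA₀
  set η : ℝ := 1 / (6 * A₀) with hη
  set Cbig : ℝ := 2 * A₀ * ((W + r) * ((2 * (L₀ + r) + 1) * W)) with hCbig
  set Csmall : ℝ := Real.exp (m * (4 * L₀ + 3 * r)) with hCsmall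
  have hW1 : 1 ≤ W := by rw [hWdef]; unfold Wc; exact_mod_cast Nat.le_add_left 1 _
  have hW0 : 0 ≤ W := by linarith
  have hm0 : 0 < m := by rw [hm]; positivity
  have hA₀pos : 0 < A₀ := by rw [hA₀]; positivity
  have hη0 : 0 ≤ η := by rw [hη]; positivity
  have hL₀r : (L0c r q : ℝ) ≤ L₀ := by exact_mod_cast hL₀c
  -- `A ≤ A₀`
  have hAle : A ≤ A₀ := by
    have e1 : Real.exp (m * (q ^ 2 : ℕ)) ≤ 3 := by
      have : m * (q ^ 2 : ℕ) ≤ 1 := by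
        rw [hm, div_mul_eq_mul_div, one_mul, div_le_one (by positivity)]
        push_cast; linarith [Nat.cast_nonneg (α := ℝ) Dm]
      calc Real.exp (m * (q ^ 2 : ℕ)) ≤ Real.exp 1 := Real.exp_le_exp.2 this
        _ ≤ 3 := by have := Real.exp_one_lt_d9; norm_num at this; linarith
    have e2 : Real.exp (m * Dm) ≤ 3 := by
      have : m * Dm ≤ 1 := by
        rw [hm, div_mul_eq_mul_div, one_mul, div_le_one (by positivity)]
        nlinarith [Nat.cast_nonneg (α := ℝ) Dm, sq_nonneg (q : ℝ)]
      calc Real.exp (m * Dm) ≤ Real.exp 1 := Real.exp_le_exp.2 this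
        _ ≤ 3 := by have := Real.exp_one_lt_d9; norm_num at this; linarith
    have e3 : (2 * ((q ^ 2 : ℕ) : ℝ) + 1) ^ 2 ≤ 9 * (q : ℝ) ^ 4 := by
      have hx : (1 : ℝ) ≤ q := by exact_mod_cast hq1
      push_cast
      nlinarith [one_le_pow₀ (n := 2) hx, sq_nonneg (q : ℝ)]
    have e4 : 3 * ε * V ≤ 1 := by
      rw [hV]; push_cast
      calc 3 * ε * (2 * (L₀ : ℝ) + 1) ^ 2 = 3 * (2 * (L₀ : ℝ) + 1) ^ 2 * ε := by ring
        _ ≤ 1 := hsmall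
    rw [hA]; unfold Acst
    have hVr : (0 : ℝ) ≤ V := Nat.cast_nonneg V
    calc (2 * ((q ^ 2 : ℕ) : ℝ) + 1) ^ 2 * Real.exp (m * ((q ^ 2 : ℕ) : ℝ)) + ε * V * Real.exp (m * Dm)
        ≤ 9 * (q : ℝ) ^ 4 * 3 + ε * V * 3 :=
          add_le_add (mul_le_mul e3 e1 (Real.exp_pos _).le (by positivity))
            (mul_le_mul_of_nonneg_left e2 (mul_nonneg hε0 hVr))
      _ ≤ 28 * (q : ℝ) ^ 4 := by
          have hx : (1 : ℝ) ≤ q := by exact_mod_cast hq1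
          nlinarith [one_le_pow₀ (n := 4) hx]
  have hA0' : 0 ≤ A := by rw [hA]; unfold Acst; positivity
  -- the `η`-conditions
  have hη1 : (r : ℝ) ≤ η * W := by
    rw [hη, hWdef, hA₀]; unfold Wc; push_cast
    rw [div_mul_eq_mul_div, one_mul, le_div_iff₀ (by positivity)]
    nlinarith [Nat.cast_nonneg (α := ℝ) r]
  have hη2 : W + 2 * r ≤ η * (2 * L₀ + 1) := by
    rw [hη, hWdef, hA₀]; unfold Wc; push_cast
    unfold L0c at hL₀r; push_cast at hL₀r
    rw [div_mul_eq_mul_div, one_mul, le_div_iff₀ (by positivity)]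
    nlinarith [Nat.cast_nonneg (α := ℝ) r, pow_nonneg (Nat.cast_nonneg (α := ℝ) q) 4]
  have hAη : A * (2 * η + η ^ 2) ≤ 1 / 2 := by
    have hη6 : η ≤ 1 / 6 := by
      rw [hη, hA₀]
      have hx : (1 : ℝ) ≤ q := by exact_mod_cast hq1
      have : (1 : ℝ) ≤ 28 * (q : ℝ) ^ 4 := by nlinarith [one_le_pow₀ (n := 4) hx]
      rw [div_le_div_iff₀ (by positivity) (by norm_num)]
      linarith
    have h3η : 2 * η + η ^ 2 ≤ 3 * η := by nlinarith
    calc A * (2 * η + η ^ 2) ≤ A₀ * (3 * η) := mul_le_mul hAle h3η (by positivity) hA₀pos.le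
      _ = 1 / 2 := by rw [hη]; field_simp; ring
  refine ⟨Cbig + Csmall, by positivity, fun L => ?_⟩
  intro Δ hΔ y hy τ τ' hττ' E hE hdep
  set Λ := centeredCube 2 L with hΛ
  have hexp0 : 0 < Real.exp (-(m * (finsetSupDist Δ {y} : ℝ))) := Real.exp_pos _
  show |(U.spec β Λ τ).real E - (U.spec β Λ τ').real E| ≤
    (Cbig + Csmall) * Real.exp (-(m * (finsetSupDist Δ {y} : ℝ)))
  by_cases hL : 2 * L₀ + r + 1 ≤ L
  · -- LARGE SQUARES: the block coupling
    set P : ℤ := (L : ℤ) - L₀ with hP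
    have hPge : (L₀ : ℤ) + r + 1 ≤ P := by rw [hP]; omega
    have hP0 : 0 ≤ P := by linarith [Nat.cast_nonneg (α := ℤ) L₀]
    have hZ1 := one_le_Z hW1 hP0
    have hZpos : 0 < Z P W := by linarith
    -- the hypotheses of the abstract theorem
    have hBΛ : ∀ i : ↥(posSet P), blk L₀ (i : Site 2) ⊆ Λ := fun i =>
      blk_subset fun k => ((mem_posSet.1 i.2) k).trans_eq hP
    have hπ0 : ∀ i : ↥(posSet P), 0 ≤ πw P W i := fun i => div_nonneg (ω_nonneg hW0 _) hZpos.le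
    have hπ1 : ∑ i : ↥(posSet P), πw P W i = 1 := sum_πw hZpos.ne'
    have hIN : ∀ (i : ↥(posSet P)) (ζ₁ ζ₂ : ↥Λ → S) (E' : Set (Site 2 → S)), MeasurableSet E' →
        DependsOn (· ∈ E') {x | x ∈ blk L₀ (i : Site 2) ∧ ∀ z ∈ rOuterBoundary r (blk L₀ (i : Site 2)),
          glueWith Λ ζ₁ τ z ≠ glueWith Λ ζ₂ τ' z → q ^ 2 < supDist x z} →
        |(U.spec β (blk L₀ (i : Site 2)) (glueWith Λ ζ₁ τ)).real E' -
            (U.spec β (blk L₀ (i : Site 2)) (glueWith Λ ζ₂ τ')).real E'| ≤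
          ε * ((rOuterBoundary r (blk L₀ (i : Site 2))).filter
            (fun z => glueWith Λ ζ₁ τ z ≠ glueWith Λ ζ₂ τ' z)).card :=
      fun i ζ₁ ζ₂ E' hE' hdep' => input_blk U β hε0 hFS (i : Site 2) _ _ hE' hdep'
    have hVi : ∀ i : ↥(posSet P), (blk L₀ (i : Site 2)).card ≤ V := fun i => (card_blk L₀ _).le
    have hDmi : ∀ i : ↥(posSet P), ∀ z ∈ rOuterBoundary r (blk L₀ (i : Site 2)), ∀ x ∈ blk L₀ (i : Site 2),
        supDist x z ≤ Dm := fun i z hz x hx => supDist_le_of_blk hx hz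
    have hκ0 : 0 < 1 / (2 * Z P W) := by positivity
    have hκ1 : 1 / (2 * Z P W) ≤ 1 := by rw [div_le_one (by positivity)]; linarith
    have hG2 : ∀ z ∈ Λ, A * bdP (r := r) (B := fun i : ↥(posSet P) => blk L₀ (i : Site 2)) (π := πw P W) z +
        1 / (2 * Z P W) ≤ covP (B := fun i : ↥(posSet P) => blk L₀ (i : Site 2)) (π := πw P W) z := by
      intro z hz
      refine covering hW1 hPge hη0 hη1 hη2 hA0' (hAη.trans_eq' ?_) fun k => ?_
      · rfl
      · have := (mem_centeredCube.1 hz) k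
        rw [hP, abs_le]; constructor <;> linarith
    have main := abs_sub_le_of_blockFamily U β τ τ' (q ^ 2) hττ' hBΛ hπ0 hπ1 hε0 hIN hm0.le hVi hDmi
      hκ0 hκ1 hG2 hΔ hE hdep
    refine main.trans (mul_le_mul_of_nonneg_right ?_ hexp0.le)
    -- the constant: `A · bdP(y) · 2Z ≤ Cbig ≤ Cbig + Csmall`
    have hn0 : ∀ t, 0 ≤ near1 P L₀ r W t := fun t =>
      Finset.sum_nonneg fun u _ => mul_nonneg (ω1_nonneg hW0 u) (by split_ifs <;> norm_num)
    have hc0 : ∀ t, 0 ≤ cov1 P L₀ W t := fun t =>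
      Finset.sum_nonneg fun u _ => mul_nonneg (ω1_nonneg hW0 u) (by split_ifs <;> norm_num)
    have hbd : bdP (r := r) (B := fun i : ↥(posSet P) => blk L₀ (i : Site 2)) (π := πw P W) y * Z P W ≤
        (W + r) * ((2 * (L₀ + r) + 1) * W) := by
      have h1 := mul_le_mul_of_nonneg_right (bdP_le (r := r) (L₀ := L₀) hW0 hZpos y) hZpos.le
      rw [div_mul_cancel₀ _ hZpos.ne', Fin.prod_univ_two, Fin.prod_univ_two] at h1
      have h2 : near1 P L₀ r W (y 0) * near1 P L₀ r W (y 1) ≤ (W + r) * ((2 * (L₀ + r) + 1) * W) := by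
        -- `y ∉ Λ_L`: one coordinate is beyond `L = P + L₀`
        have hout : ∃ k, P + L₀ < |y k| := by
          by_contra hcon
          push Not at hcon
          exact hy (mem_centeredCube.2 fun k => by
            have := abs_le.1 (hcon k); rw [hP] at this; constructor <;> linarith)
        obtain ⟨k, hk⟩ := hout
        fin_cases k
        · exact mul_le_mul (near1_le_of_out hW1 hPge hk) (near1_le hW1 _) (hn0 _) (by positivity)
        · rw [mul_comm]
          exact mul_le_mul (near1_le_of_out hW1 hPge hk) (near1_le hW1 _) (hn0 _) (by positivity)
      nlinarith [mul_nonneg (hc0 (y 0)) (hc0 (y 1))]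
    have hbd0 : 0 ≤ bdP (r := r) (B := fun i : ↥(posSet P) => blk L₀ (i : Site 2)) (π := πw P W) y :=
      Finset.sum_nonneg fun i _ => mul_nonneg (hπ0 i) (by split_ifs <;> norm_num)
    have hCs : 0 ≤ Csmall := (Real.exp_pos _).le
    calc A * bdP (r := r) (B := fun i : ↥(posSet P) => blk L₀ (i : Site 2)) (π := πw P W) y / (1 / (2 * Z P W))
        = 2 * A * (bdP (r := r) (B := fun i : ↥(posSet P) => blk L₀ (i : Site 2)) (π := πw P W) y * Z P W) := by
          field_simp
      _ ≤ 2 * A₀ * ((W + r) * ((2 * (L₀ + r) + 1) * W)) :=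
          mul_le_mul (by linarith) hbd (mul_nonneg hbd0 hZpos.le) (by positivity)
      _ ≤ Cbig + Csmall := by rw [hCbig]; linarith
  · -- SMALL SQUARES: the trivial bound
    push Not at hL
    have hγs := U.isSpecification_spec β
    haveI := hγs.isProbability Λ τ
    haveI := hγs.isProbability Λ τ'
    have h1 : |(U.spec β Λ τ).real E - (U.spec β Λ τ').real E| ≤ 1 := by
      rw [abs_sub_le_iff]
      constructor <;> linarith [measureReal_nonneg (μ := U.spec β Λ τ) (s := E),
        measureReal_nonneg (μ := U.spec β Λ τ') (s := E),
        measureReal_le_one (μ := U.spec β Λ τ) (s := E), measureReal_le_one (μ := U.spec β Λ τ') (s := E)]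
    by_cases hyr : ∀ j, (y j).natAbs ≤ L + r
    · -- `d(Δ, y) ≤ 2L + r ≤ 4L₀ + 3r`
      have hd : (finsetSupDist Δ {y} : ℝ) ≤ 4 * L₀ + 3 * r := by
        rcases Δ.eq_empty_or_nonempty with hΔe | ⟨x, hx⟩
        · rw [hΔe]; simp [finsetSupDist]; positivity
        · have e1 := finsetSupDist_le hx (Finset.mem_singleton_self y)
          have e2 := supDist_le_of_mem_centeredCube (r := r) (hΔ hx) hyr
          have : finsetSupDist Δ {y} ≤ 4 * L₀ + 3 * r := by omega
          exact_mod_cast this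
      have h2 : 1 ≤ Csmall * Real.exp (-(m * (finsetSupDist Δ {y} : ℝ))) := by
        rw [hCsmall, ← Real.exp_add]
        exact Real.one_le_exp (by nlinarith [hm0.le])
      have hCb : 0 ≤ Cbig := by rw [hCbig]; positivity
      calc |(U.spec β Λ τ).real E - (U.spec β Λ τ').real E| ≤ 1 := h1
        _ ≤ Csmall * Real.exp (-(m * (finsetSupDist Δ {y} : ℝ))) := h2
        _ ≤ (Cbig + Csmall) * Real.exp (-(m * (finsetSupDist Δ {y} : ℝ))) :=
            mul_le_mul_of_nonneg_right (by linarith) hexp0.le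
    · -- `y` farther than `r` from the square
      rw [spec_real_eq_of_far U β hyr hττ' hE (hdep.mono fun x hx => Finset.mem_coe.2 (hΔ (Finset.mem_coe.1 hx))),
        sub_self, abs_zero]
      positivity

omit [DecidableEq S] in
/-- **[MOS94] Theorem 1.1** for a non-empty spin space (the substance): weak mixing for all finite volumes
implies strong mixing on all squares `Λ_L`, with `L`-independent constants: (2.1) at free scales
(`WeakMixingSurgery.MOS1994_eq2_1_scales`) supplies the finite-size input of `strongMixing_of_finiteSize` at
the scale `q` of `exists_scale`. [cite: MartinelliOlivieriSchonmann1994, Theorem 1.1] -/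
theorem weakMixing_imp_strongMixing (U : FRPotential 2 S r) : MOS1994_weakMixing_imp_strongMixing U := by
  intro β _hβ C γr hC hγ hWM
  obtain ⟨δ₀, hδ0, hδ1, Q, hQ⟩ := MOS1994_eq2_1_scales U β hC.le hγ hWM
  obtain ⟨q, hqQ, hq3, hsmall⟩ := exists_scale r hδ0 hδ1 Q
  have hq1 : 1 ≤ q := by omega
  have hε0 : 0 ≤ (1 - δ₀) ^ (q - 3) := pow_nonneg (by linarith) _
  obtain ⟨C', hC', hSM⟩ := strongMixing_of_finiteSize U β hq1 le_rfl hε0 hsmall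
    (fun τ τ' E hE hdep => hQ q hqQ (L0c r q) τ τ' (pow_le_L0c r q) E hE hdep)
  exact ⟨C', _, hC', by positivity, hSM⟩

end WeakMixingSquares

/-- **[MOS94] Theorem 1.1 — DISCHARGE of the named fact `MOS1994_weakMixing_imp_strongMixing`**: in two
dimensions, weak mixing of the Gibbs measures of a finite-range, translation-invariant, finite-spin
interaction for all finite volumes implies strong mixing on every square `Λ_L` (constants independent of
`L`). [cite: MartinelliOlivieriSchonmann1994, Theorem 1.1] -/
theorem MOS1994_weakMixing_imp_strongMixing_holds {S : Type*} [MeasurableSpace S] [Fintype S]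
    [MeasurableSingletonClass S] {r : ℕ} (U : FRPotential 2 S r) : MOS1994_weakMixing_imp_strongMixing U := by
  classical
  rcases isEmpty_or_nonempty S with hS | hS
  · intro β _ C γr hC hγ _
    refine ⟨1, 1, one_pos, one_pos, fun L Δ _ y _ τ => ?_⟩
    exact (hS.false (τ 0)).elim
  · exact WeakMixingSquares.weakMixing_imp_strongMixing U

end Literature.Probability.LatticeModels
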